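import Literature.Probability.Percolation.MarkedLoopPatternCensus
import HarnessLib

/-!
# Numeric census tables: configurations as bitmasks, face labellings as digit codes («PATTERN-CENSUS-MASKS»)

Topic `Literature/Probability/Percolation`; a rider on the census kit `MarkedLoopPatternCensus.lean` («PATTERN-CENSUS»: a complete injective table
`cfg : ι → Finset (Sym2 (Site 2))` of a boundary XOR space with a face labelling per configuration yields the boundary pattern counts by finite checks).
The kit is table-agnostic; this file supplies a COMPACT, KERNEL-FRIENDLY way to present the tables and to discharge the kit's per-configuration
hypotheses by checks on NATURAL NUMBERS (bit tests and digit extractions, which the kernel evaluates with GMP arithmetic) instead of membership tests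
in finsets of `Sym2 (Fin 2 → ℤ)` literals:

* `bondsOfMask L m` — the finset of the bonds of the list `L` selected by the bits of `m` (bit `n` ↔ `L[n]`); ★ `mem_bondsOfMask_iff`
  (`b ∈ bondsOfMask L m ↔ ∃ n, L[n]? = some b ∧ m.testBit n`), `bondsOfMask_subset_toFinset`, `getElem_mem_bondsOfMask_iff` (for `L` without duplicates:
  `L[n] ∈ bondsOfMask L m ↔ m.testBit n`);
* `labOfCode F Φ c` — the label of the face `F` read from the base-64 digits of the code `c` along the face list `Φ` (faces off the list get their
  injective `faceCode ≥ 1000`); ★ `labOfCode_getElem` (for `Φ` without duplicates the label of `Φ[f]` is the digit `(c / 64 ^ f) % 64`), `labOfCode_of_not_mem`;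
* `sideBit`, `sideCount m idx` — the bits of `m` at a face's tabulated side indices and their number; ★ `xiDeg_bondsOfMask_eq_sideCount` — with a correct
  side-index table the side count `xiDeg (bondsOfMask L m) F` IS `sideCount m idx`; `parityCheck` / ★ `parity_of_parityCheck` — the kit's parity profile at
  every listed face from ONE Boolean function of the mask (evaluated by the kernel on numbers);
* `digit`, `closedCheck` / ★ `closed_of_closedCheck` — the kit's label-closure hypothesis from one Boolean function of (mask, code) and the once-per-file
  tables of side indices and opposite-face indices; `uniqCheck` / ★ `uniq_of_uniqCheck`, `completeCheck` / ★ `complete_of_completeCheck` — the partner and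
  link-relation hypotheses from Boolean functions of the code and the corner-index table;
* `field` — fixed-width fields of a packed numeric table; `freeCodeN` / ★ `freeCode_bondsOfMask` — the kit's free code read on the mask;
* ★ `surj_free_of_decode` — if the table is indexed by `Fin (2 ^ n)` and the free part of `cfg t`, read as a number through an enumeration
  `free : Fin n → _` of the free bonds, is `t`, then every subset of the free bonds is the free part of some `cfg t` (the kit's completeness hypothesis
  `hsurj`, obtained from ONE equation per configuration instead of a search over all subsets — injective self-maps of a finite type are surjective).

No statement about loop models is made here beyond the kit's; the lane's census generator (`gen_ed4.py`, HOME `pub-sawmu-b-engine-2/gen28/`) instantiates these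
lemmas once per census file.

## References
* M. Khristoforov, S. Smirnov, *Percolation and O(1) loop model*, arXiv:2111.15612 (2021), §1.2 (arXiv v1 pp. 2–3: `W_Ω(U) = {ξ : ∂ξ = U}` on half-edges,
  «exactly `2^{#Faces(Ω)}` loop configurations», the link pattern).
* B. Bollobás, O. Riordan, *Percolation*, Cambridge University Press (2006), Ch. 7 Lemma 12 (pp. 206–207: faces and their sides).

## Mathlib / tree
Tree: `MarkedLoopPatternCensus.lean` (`faceCode`), `FivePointHolomorphy`/`FiveMarkedLoopSpace` (`xiDeg`, `side`). Mathlib: `Nat.testBit_zero`, `Nat.testBit_succ`,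
`List.getElem?_cons_succ`, `List.Nodup`, `Finite.surjective_of_injective`, `Finset.card_powerset`.
-/

open Finset

namespace Literature.Probability.Percolation.MarkedLoops

open Literature.Probability.Percolation Literature.Probability.LatticeModels
open Literature.Probability.Percolation.FivePoint (xiDeg side)

/-! ### Configurations as bitmasks over a bond list -/
section Masks

variable {α : Type*} [DecidableEq α]

/-- the finset of the list elements selected by the bits of `m`: bit `0` decides the head, bit `n` the `n`-th element.
[cite: KhristoforovSmirnov2021, §1.2 (arXiv v1 p. 3: «exactly `2^{#Faces(Ω)}` loop configurations»)] -/
def bondsOfMask : List α → ℕ → Finset α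
  | [], _ => ∅
  | b :: l, m => if m % 2 = 1 then insert b (bondsOfMask l (m / 2)) else bondsOfMask l (m / 2)

omit [DecidableEq α] in
/-- bit bookkeeping: `testBit` at a successor reads the halved number. [cite: KhristoforovSmirnov2021, §1.2 (arXiv v1 p. 3: «exactly `2^{#Faces(Ω)}` loop configurations»); lane plumbing] -/
private theorem testBit_succ' (m n : ℕ) : m.testBit (n + 1) = (m / 2).testBit n := Nat.testBit_succ m n

/-- ★ membership in the decoded finset: `b` is selected iff it sits at a position whose bit is set. [cite: KhristoforovSmirnov2021, §1.2 (arXiv v1 p. 3: «exactly `2^{#Faces(Ω)}` loop configurations»); lane plumbing] -/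
theorem mem_bondsOfMask_iff : ∀ (L : List α) (m : ℕ) (b : α), b ∈ bondsOfMask L m ↔ ∃ n, L[n]? = some b ∧ m.testBit n = true
  | [], m, b => by simp [bondsOfMask]
  | c :: l, m, b => by
    have ih := mem_bondsOfMask_iff l (m / 2) b
    have hdef : bondsOfMask (c :: l) m = (if m % 2 = 1 then insert c (bondsOfMask l (m / 2)) else bondsOfMask l (m / 2)) := rfl
    have key : (b ∈ bondsOfMask (c :: l) m) ↔ ((m % 2 = 1 ∧ b = c) ∨ b ∈ bondsOfMask l (m / 2)) := by
      rw [hdef]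
      split_ifs with h
      · rw [Finset.mem_insert]; constructor
        · rintro (rfl | hb); exacts [Or.inl ⟨h, rfl⟩, Or.inr hb]
        · rintro (⟨-, rfl⟩ | hb); exacts [Or.inl rfl, Or.inr hb]
      · constructor
        · exact fun hb => Or.inr hb
        · rintro (⟨h', -⟩ | hb); exacts [absurd h' h, hb]
    rw [key, ih]
    constructor
    · rintro (⟨hm, rfl⟩ | ⟨n, hn, hb⟩)
      · exact ⟨0, by simp, by rw [Nat.testBit_zero]; exact decide_eq_true hm⟩
      · exact ⟨n + 1, by simpa using hn, by rw [testBit_succ']; exact hb⟩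
    · rintro ⟨n, hn, hb⟩
      cases n with
      | zero =>
        simp only [List.getElem?_cons_zero, Option.some.injEq] at hn
        rw [Nat.testBit_zero, decide_eq_true_eq] at hb
        exact Or.inl ⟨hb, hn.symm⟩
      | succ n =>
        rw [List.getElem?_cons_succ] at hn
        rw [testBit_succ'] at hb
        exact Or.inr ⟨n, hn, hb⟩

/-- the decoded finset lies in the list. [cite: KhristoforovSmirnov2021, §1.2 (arXiv v1 p. 3: «exactly `2^{#Faces(Ω)}` loop configurations»); lane plumbing] -/
theorem bondsOfMask_subset_toFinset (L : List α) (m : ℕ) : bondsOfMask L m ⊆ L.toFinset := by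
  intro b hb
  obtain ⟨n, hn, -⟩ := (mem_bondsOfMask_iff L m b).1 hb
  exact List.mem_toFinset.2 (List.mem_of_getElem? hn)

/-- every decoded element satisfies a property that holds along the list. [cite: KhristoforovSmirnov2021, §1.2 (arXiv v1 p. 3: «exactly `2^{#Faces(Ω)}` loop configurations»); lane plumbing] -/
theorem forall_mem_bondsOfMask {L : List α} {P : α → Prop} (h : ∀ b ∈ L, P b) (m : ℕ) : ∀ b ∈ bondsOfMask L m, P b :=
  fun b hb => h b (List.mem_toFinset.1 (bondsOfMask_subset_toFinset L m hb))

/-- ★ for a list WITHOUT DUPLICATES the `n`-th element is selected iff bit `n` is set. [cite: KhristoforovSmirnov2021, §1.2 (arXiv v1 p. 3: «exactly `2^{#Faces(Ω)}` loop configurations»); lane plumbing] -/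
theorem getElem_mem_bondsOfMask_iff {L : List α} (hL : L.Nodup) {n : ℕ} (hn : n < L.length) (m : ℕ) :
    L[n] ∈ bondsOfMask L m ↔ m.testBit n = true := by
  rw [mem_bondsOfMask_iff]
  constructor
  · rintro ⟨n', hn', hb⟩
    have e : n' = n := by
      have h1 : L[n']? = L[n]? := by rw [hn', List.getElem?_eq_getElem hn]
      obtain ⟨hlt, -⟩ := List.getElem?_eq_some_iff.1 hn'
      exact (List.Nodup.getElem_inj_iff hL).1 (by
        have := h1; rw [List.getElem?_eq_getElem hlt, List.getElem?_eq_getElem hn, Option.some.injEq] at this; exact this)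
    rw [← e]; exact hb
  · intro hb
    exact ⟨n, List.getElem?_eq_getElem hn, hb⟩

/-- membership of a tabulated element through an index table: if `o = some n` points at `b` in a list without duplicates (and `o = none` means `b`
is off the list) then `b` is selected iff the indexed bit is set. [cite: KhristoforovSmirnov2021, §1.2 (arXiv v1 p. 3: «exactly `2^{#Faces(Ω)}` loop configurations»); lane plumbing] -/
theorem mem_bondsOfMask_iff_of_index {L : List α} (hL : L.Nodup) {b : α} {o : Option ℕ}
    (hsome : ∀ n, o = some n → L[n]? = some b) (hnone : o = none → b ∉ L) (m : ℕ) :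
    b ∈ bondsOfMask L m ↔ (∃ n, o = some n ∧ m.testBit n = true) := by
  cases ho : o with
  | none =>
    constructor
    · intro hb; exact absurd (List.mem_toFinset.1 (bondsOfMask_subset_toFinset L m hb)) (hnone ho)
    · rintro ⟨n, hn, -⟩; exact absurd hn (by simp)
  | some n =>
    have hLn := hsome n ho
    obtain ⟨hlt, heq⟩ := List.getElem?_eq_some_iff.1 hLn
    rw [← heq, getElem_mem_bondsOfMask_iff hL hlt]
    constructor
    · intro h; exact ⟨n, rfl, h⟩
    · rintro ⟨n', hn', h⟩; rw [Option.some.injEq] at hn'; rw [hn']; exact h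

/-- the `i`-th field of width `w` bits of a packed table (tables of a census file are single numerals; the kernel reads fields with GMP arithmetic). [cite: KhristoforovSmirnov2021, §1.2 (arXiv v1 p. 3: «exactly `2^{#Faces(Ω)}` loop configurations»); lane plumbing] -/
def field (tab w i : ℕ) : ℕ := tab / 2 ^ (w * i) % 2 ^ w

end Masks

/-! ### Side counts on the masks -/
section SideCounts

variable {α : Type*} [DecidableEq α]

/-- the bit of `m` selected by an optional index (`none` ↦ `false`). [cite: KhristoforovSmirnov2021, §1.2 (arXiv v1 p. 3: «exactly `2^{#Faces(Ω)}` loop configurations»); lane plumbing] -/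
def sideBit (m : ℕ) : Option ℕ → Bool
  | none => false
  | some n => m.testBit n

/-- membership of a tabulated element through an index table into a list without duplicates (`some n` points at it, `none` = off the list) is the
selected bit. [cite: KhristoforovSmirnov2021, §1.2 (arXiv v1 p. 3: «exactly `2^{#Faces(Ω)}` loop configurations»); lane plumbing] -/
theorem mem_bondsOfMask_iff_sideBit {L : List α} (hL : L.Nodup) {b : α} {o : Option ℕ}
    (hsome : ∀ n, o = some n → L[n]? = some b) (hnone : o = none → b ∉ L) (m : ℕ) :
    b ∈ bondsOfMask L m ↔ sideBit m o = true := by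
  rw [mem_bondsOfMask_iff_of_index hL hsome hnone m]
  cases o with
  | none => simp [sideBit]
  | some n => simp [sideBit]

/-- the number of sides `j : Fin 3` of a face whose tabulated bond index carries a set bit of `m`. [cite: BollobasRiordan2006, Ch. 7 Lemma 12 (pp. 206–207)] -/
def sideCount (m : ℕ) (idx : Fin 3 → Option ℕ) : ℕ :=
  #((Finset.univ : Finset (Fin 3)).filter fun j => sideBit m (idx j) = true)

/-- ★ **PARITY ON THE MASKS**: with a correct side-index table of the face `F` (into a bond list without duplicates) the side count of the decoded
configuration at `F` is `sideCount`. [cite: KhristoforovSmirnov2021, §1.2 (arXiv v1 pp. 2–3: `∂ξ = U`); BollobasRiordan2006, Ch. 7 Lemma 12 (pp. 206–207)] -/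
theorem xiDeg_bondsOfMask_eq_sideCount {L : List (Sym2 (Site 2))} (hL : L.Nodup) (F : HexVertex) (idx : Fin 3 → Option ℕ)
    (hsome : ∀ j n, idx j = some n → L[n]? = some (side F j)) (hnone : ∀ j, idx j = none → side F j ∉ L) (m : ℕ) :
    xiDeg (bondsOfMask L m) F = sideCount m idx := by
  unfold sideCount
  have e : xiDeg (bondsOfMask L m) F = #((Finset.univ : Finset (Fin 3)).filter fun j => side F j ∈ bondsOfMask L m) := by
    unfold xiDeg side; rfl
  rw [e]
  congr 1
  exact Finset.filter_congr fun j _ => mem_bondsOfMask_iff_sideBit hL (hsome j) (hnone j) m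

/-- **the Boolean parity check of one configuration**: at every listed face the side count has the tabulated parity. [cite: KhristoforovSmirnov2021, §1.2 (arXiv v1 pp. 2–3)] -/
def parityCheck (sideIdx : ℕ → Fin 3 → Option ℕ) (oddBit : ℕ → Bool) (nF m : ℕ) : Bool :=
  (List.range nF).all fun f => (sideCount m (sideIdx f) % 2 == 1) == oddBit f

/-- ★ **PARITY PROFILE FROM THE BOOLEAN CHECK**: the kit's parity hypothesis at every listed face, from `parityCheck` and the once-per-file table facts.
[cite: KhristoforovSmirnov2021, §1.2 (arXiv v1 pp. 2–3: `W_Ω(U) = {ξ : ∂ξ = U}`)] -/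
theorem parity_of_parityCheck {L : List (Sym2 (Site 2))} (hL : L.Nodup) {Φ : List HexVertex} (sideIdx : ℕ → Fin 3 → Option ℕ)
    (hsome : ∀ (f : ℕ) (hf : f < Φ.length) (j : Fin 3) (n : ℕ), sideIdx f j = some n → L[n]? = some (side Φ[f] j))
    (hnone : ∀ (f : ℕ) (hf : f < Φ.length) (j : Fin 3), sideIdx f j = none → side Φ[f] j ∉ L)
    (oddBit : ℕ → Bool) (odd : Finset HexVertex) (hodd : ∀ (f : ℕ) (hf : f < Φ.length), oddBit f = true ↔ Φ[f] ∈ odd)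
    {m : ℕ} (h : parityCheck sideIdx oddBit Φ.length m = true) :
    ∀ F ∈ Φ, (xiDeg (bondsOfMask L m) F % 2 = 1 ↔ F ∈ odd) := by
  intro F hF
  obtain ⟨f, hf, rfl⟩ := List.getElem_of_mem hF
  have hcheck : ((sideCount m (sideIdx f) % 2 == 1) == oddBit f) = true := by
    unfold parityCheck at h
    exact List.all_eq_true.1 h f (List.mem_range.2 hf)
  rw [xiDeg_bondsOfMask_eq_sideCount hL Φ[f] (sideIdx f) (hsome f hf) (hnone f hf) m, ← hodd f hf]
  have e : (sideCount m (sideIdx f) % 2 == 1) = oddBit f := by simpa using hcheck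
  rw [← e, beq_iff_eq]

end SideCounts

/-! ### Face labellings as digit codes -/
section Codes

/-- the label of the face `F` read from the base-64 digits of `c` along the face list `Φ`: the digit at the first occurrence of `F`, or the injective
`faceCode F` when `F` is off the list. [cite: KhristoforovSmirnov2021, §1.2 (arXiv v1 p. 2: the link pattern)] -/
def labOfCode (F : HexVertex) : List HexVertex → ℕ → ℕ
  | [], _ => faceCode F
  | G :: l, c => if F = G then c % 64 else labOfCode F l (c / 64)

/-- off the list the label is the face code. [cite: KhristoforovSmirnov2021, §1.2 (arXiv v1 p. 2: the link pattern); lane plumbing] -/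
theorem labOfCode_of_not_mem {F : HexVertex} : ∀ {Φ : List HexVertex}, F ∉ Φ → ∀ c, labOfCode F Φ c = faceCode F
  | [], _, _ => rfl
  | G :: l, h, c => by
    have hdef : labOfCode F (G :: l) c = (if F = G then c % 64 else labOfCode F l (c / 64)) := rfl
    rw [hdef, if_neg (fun e => h (List.mem_cons.2 (Or.inl e)))]
    exact labOfCode_of_not_mem (fun h' => h (List.mem_cons.2 (Or.inr h'))) (c / 64)

/-- digit bookkeeping. [cite: KhristoforovSmirnov2021, §1.2 (arXiv v1 p. 2: the link pattern); lane plumbing] -/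
private theorem div_pow_succ (c f : ℕ) : c / 64 / 64 ^ f = c / 64 ^ (f + 1) := by
  rw [Nat.div_div_eq_div_mul, pow_succ, mul_comm]

/-- ★ on a face list WITHOUT DUPLICATES the label of the `f`-th face is the `f`-th digit. [cite: KhristoforovSmirnov2021, §1.2 (arXiv v1 p. 2: the link pattern); lane plumbing] -/
theorem labOfCode_getElem : ∀ {Φ : List HexVertex}, Φ.Nodup → ∀ {f : ℕ} (hf : f < Φ.length) (c : ℕ), labOfCode Φ[f] Φ c = c / 64 ^ f % 64
  | [], _, f, hf, _ => absurd hf (Nat.not_lt_zero f)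
  | G :: l, hΦ, f, hf, c => by
    obtain ⟨hG, hl⟩ := List.nodup_cons.1 hΦ
    cases f with
    | zero => simp [labOfCode]
    | succ f =>
      have hf' : f < l.length := by simpa using hf
      have hne : l[f] ≠ G := fun e => hG (e ▸ List.getElem_mem hf')
      rw [List.getElem_cons_succ]
      have hdef : labOfCode l[f] (G :: l) c = (if l[f] = G then c % 64 else labOfCode l[f] l (c / 64)) := rfl
      rw [hdef, if_neg hne, labOfCode_getElem hl hf' (c / 64), div_pow_succ]

end Codes

/-! ### Label closure on the numbers -/
section Closure

/-- the `f`-th base-64 digit. [cite: KhristoforovSmirnov2021, §1.2 (arXiv v1 p. 2: the link pattern); lane plumbing] -/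
def digit (c f : ℕ) : ℕ := c / 64 ^ f % 64

/-- **the Boolean closure check of one configuration**: every selected bond (read through the side-index table of every listed face) joins two
faces with the same digit. [cite: KhristoforovSmirnov2021, §1.2 (arXiv v1 p. 2: the link pattern «a union of disjoint paths»)] -/
def closedCheck (sideIdx : ℕ → Fin 3 → Option ℕ) (oppIdx : ℕ → Fin 3 → ℕ) (nF m c : ℕ) : Bool :=
  (List.range nF).all fun f => (List.finRange 3).all fun j =>
    !(sideBit m (sideIdx f j)) || (digit c (oppIdx f j) == digit c f)

/-- ★ **LABEL CLOSURE FROM THE BOOLEAN CHECK**: the kit's closure hypothesis (the labelling `labOfCode · Φ c` is constant across the bonds of the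
decoded configuration) at every listed face, from `closedCheck` and the once-per-file table facts (side indices, opposite-face indices).
[cite: KhristoforovSmirnov2021, §1.2 (arXiv v1 p. 2); BollobasRiordan2006, Ch. 7 Lemma 12 (pp. 206–207: opposite faces)] -/
theorem closed_of_closedCheck {L : List (Sym2 (Site 2))} (hL : L.Nodup) {Φ : List HexVertex} (hΦ : Φ.Nodup)
    (sideIdx : ℕ → Fin 3 → Option ℕ) (oppIdx : ℕ → Fin 3 → ℕ)
    (hsome : ∀ (f : ℕ) (hf : f < Φ.length) (j : Fin 3) (n : ℕ), sideIdx f j = some n → L[n]? = some (side Φ[f] j))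
    (hnone : ∀ (f : ℕ) (hf : f < Φ.length) (j : Fin 3), sideIdx f j = none → side Φ[f] j ∉ L)
    (hopp : ∀ (f : ℕ) (hf : f < Φ.length) (j : Fin 3), sideIdx f j ≠ none → Φ[oppIdx f j]? = some (oppFace Φ[f] j))
    {m c : ℕ} (h : closedCheck sideIdx oppIdx Φ.length m c = true) :
    ∀ F ∈ Φ, ∀ j : Fin 3, side F j ∈ bondsOfMask L m → labOfCode (oppFace F j) Φ c = labOfCode F Φ c := by
  intro F hF j hside
  obtain ⟨f, hf, rfl⟩ := List.getElem_of_mem hF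
  have hbit : sideBit m (sideIdx f j) = true := (mem_bondsOfMask_iff_sideBit hL (hsome f hf j) (hnone f hf j) m).1 hside
  have hcheck : (!(sideBit m (sideIdx f j)) || (digit c (oppIdx f j) == digit c f)) = true := by
    unfold closedCheck at h
    exact List.all_eq_true.1 (List.all_eq_true.1 h f (List.mem_range.2 hf)) j (List.mem_finRange j)
  rw [hbit] at hcheck
  have hdig : digit c (oppIdx f j) = digit c f := by simpa using hcheck
  have hne : sideIdx f j ≠ none := fun e => by rw [e] at hbit; exact Bool.false_ne_true hbit
  obtain ⟨hlt, heq⟩ := List.getElem?_eq_some_iff.1 (hopp f hf j hne)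
  rw [← heq, labOfCode_getElem hΦ hlt, labOfCode_getElem hΦ hf]
  exact hdig

end Closure

/-! ### Partner and link relation on the digits -/
section Patterns

/-- **the Boolean partner check**: among the corners (read through the corner-index table) only `p` carries the digit of the odd endpoint `s` (index `sIdx`).
[cite: KhristoforovSmirnov2021, §2 Definition 3 (arXiv v1 p. 4: the class `z ↔ u_j`)] -/
def uniqCheck (k : ℕ) (cornerIdx : Fin k → ℕ) (sIdx : ℕ) (p : Fin k) (c : ℕ) : Bool :=
  (List.finRange k).all fun a => !(digit c (cornerIdx a) == digit c sIdx) || (a == p)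

/-- ★ the kit's partner-uniqueness hypothesis from the Boolean check. [cite: KhristoforovSmirnov2021, §2 Definition 3 (arXiv v1 p. 4)] -/
theorem uniq_of_uniqCheck {Φ : List HexVertex} (hΦ : Φ.Nodup) {k : ℕ} (corner : Fin k → HexVertex) (cornerIdx : Fin k → ℕ)
    (hcorner : ∀ a, Φ[cornerIdx a]? = some (corner a)) (s : HexVertex) (sIdx : ℕ) (hs : Φ[sIdx]? = some s) (p : Fin k) {c : ℕ}
    (h : uniqCheck k cornerIdx sIdx p c = true) : ∀ a : Fin k, labOfCode (corner a) Φ c = labOfCode s Φ c → a = p := by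
  intro a ha
  obtain ⟨hlt, heq⟩ := List.getElem?_eq_some_iff.1 (hcorner a)
  obtain ⟨hlt', heq'⟩ := List.getElem?_eq_some_iff.1 hs
  rw [← heq, ← heq', labOfCode_getElem hΦ hlt, labOfCode_getElem hΦ hlt'] at ha
  have hcheck : (!(digit c (cornerIdx a) == digit c sIdx) || (a == p)) = true := by
    unfold uniqCheck at h
    exact List.all_eq_true.1 h a (List.mem_finRange a)
  have hd : (digit c (cornerIdx a) == digit c sIdx) = true := by unfold digit; exact beq_iff_eq.2 ha
  rw [hd] at hcheck
  simpa using hcheck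

/-- **the Boolean link-relation check**: every pair of distinct non-partner corners with equal digits is in the tabulated relation `M`.
[cite: KhristoforovSmirnov2021, §1.2 (arXiv v1 p. 2: «IP(ξ) is a union of disjoint paths, matching marked points»)] -/
def completeCheck (k : ℕ) (cornerIdx : Fin k → ℕ) (p : Fin k) (M : Finset (Fin k × Fin k)) (c : ℕ) : Bool :=
  (List.finRange k).all fun a => (List.finRange k).all fun b =>
    (a == b) || (a == p) || (b == p) || !(digit c (cornerIdx a) == digit c (cornerIdx b)) || decide ((a, b) ∈ M)

/-- ★ the kit's relation-completeness hypothesis from the Boolean check. [cite: KhristoforovSmirnov2021, §1.2 (arXiv v1 p. 2)] -/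
theorem complete_of_completeCheck {Φ : List HexVertex} (hΦ : Φ.Nodup) {k : ℕ} (corner : Fin k → HexVertex) (cornerIdx : Fin k → ℕ)
    (hcorner : ∀ a, Φ[cornerIdx a]? = some (corner a)) (p : Fin k) (M : Finset (Fin k × Fin k)) {c : ℕ}
    (h : completeCheck k cornerIdx p M c = true) :
    ∀ a b : Fin k, a ≠ b → a ≠ p → b ≠ p → labOfCode (corner a) Φ c = labOfCode (corner b) Φ c → (a, b) ∈ M := by
  intro a b hab hap hbp hl
  obtain ⟨hlta, heqa⟩ := List.getElem?_eq_some_iff.1 (hcorner a)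
  obtain ⟨hltb, heqb⟩ := List.getElem?_eq_some_iff.1 (hcorner b)
  rw [← heqa, ← heqb, labOfCode_getElem hΦ hlta, labOfCode_getElem hΦ hltb] at hl
  have hcheck : ((a == b) || (a == p) || (b == p) || !(digit c (cornerIdx a) == digit c (cornerIdx b)) || decide ((a, b) ∈ M)) = true := by
    unfold completeCheck at h
    exact List.all_eq_true.1 (List.all_eq_true.1 h a (List.mem_finRange a)) b (List.mem_finRange b)
  have hd : (digit c (cornerIdx a) == digit c (cornerIdx b)) = true := by unfold digit; exact beq_iff_eq.2 hl
  have h1 : (a == b) = false := beq_eq_false_iff_ne.2 hab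
  have h2 : (a == p) = false := beq_eq_false_iff_ne.2 hap
  have h3 : (b == p) = false := beq_eq_false_iff_ne.2 hbp
  rw [hd, h1, h2, h3] at hcheck
  simpa using hcheck

end Patterns

/-! ### Completeness from the decode equation -/
section Decode

variable {α : Type*} [DecidableEq α]

/-- the free part of a configuration read as a number through an enumeration of the free bonds. [cite: KhristoforovSmirnov2021, §1.2 (arXiv v1 p. 3)] -/
def freeCode {n : ℕ} (free : Fin n → α) (ξ : Finset α) : ℕ := ∑ k : Fin n, if free k ∈ ξ then 2 ^ (k : ℕ) else 0

/-- the free code depends only on the free part. [cite: KhristoforovSmirnov2021, §1.2 (arXiv v1 p. 3: «exactly `2^{#Faces(Ω)}` loop configurations»); lane plumbing] -/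
private theorem freeCode_eq_of_filter_eq {n : ℕ} (free : Fin n → α) {ξ ξ' : Finset α}
    (h : ∀ k, free k ∈ ξ ↔ free k ∈ ξ') : freeCode free ξ = freeCode free ξ' := by
  unfold freeCode
  exact Finset.sum_congr rfl fun k _ => by rw [if_congr (h k) rfl rfl]

/-- the free code read on the MASK through the positions of the free bonds. [cite: KhristoforovSmirnov2021, §1.2 (arXiv v1 p. 3)] -/
def freeCodeN (n : ℕ) (freeIdx : ℕ → ℕ) (m : ℕ) : ℕ := ∑ k : Fin n, if m.testBit (freeIdx k) = true then 2 ^ (k : ℕ) else 0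

/-- ★ the free code of a decoded configuration IS the free code of its mask (bond list without duplicates, correct free-index table).
[cite: KhristoforovSmirnov2021, §1.2 (arXiv v1 p. 3)] -/
theorem freeCode_bondsOfMask {L : List α} (hL : L.Nodup) {n : ℕ} (free : Fin n → α) (freeIdx : ℕ → ℕ)
    (hidx : ∀ k : Fin n, L[freeIdx k]? = some (free k)) (m : ℕ) : freeCode free (bondsOfMask L m) = freeCodeN n freeIdx m := by
  unfold freeCode freeCodeN
  refine Finset.sum_congr rfl fun k _ => ?_
  obtain ⟨hlt, heq⟩ := List.getElem?_eq_some_iff.1 (hidx k)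
  have e : (free k ∈ bondsOfMask L m) ↔ (m.testBit (freeIdx k) = true) := by
    rw [← heq, getElem_mem_bondsOfMask_iff hL hlt]
  rw [if_congr e rfl rfl]

/-- ★ **COMPLETENESS FROM THE DECODE EQUATION**: a table indexed by `Fin (2 ^ n)` whose free codes (through an injective enumeration of the `n`
free bonds) recover the index realises EVERY subset of the free bonds — the kit's hypothesis `hsurj`, from one equation per configuration (injective self-maps of a finite type are onto).
[cite: KhristoforovSmirnov2021, §1.2 (arXiv v1 p. 3: «exactly `2^{#Faces(Ω)}` loop configurations»)] -/
theorem surj_free_of_decode {n : ℕ} (free : Fin n → α) (Free : Finset α)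
    (hFree : ∀ e, e ∈ Free ↔ ∃ k, free k = e) (cfg : Fin (2 ^ n) → Finset α) (hdec : ∀ t, freeCode free (cfg t) = t.val) :
    ∀ T ∈ Free.powerset, ∃ t, ∀ e ∈ Free, e ∈ cfg t ↔ e ∈ T := by
  classical
  -- the map `t ↦ {k | free k ∈ cfg t}` is injective, hence surjective onto `Finset (Fin n)`
  let g : Fin (2 ^ n) → Finset (Fin n) := fun t => (Finset.univ : Finset (Fin n)).filter fun k => free k ∈ cfg t
  have hg : Function.Injective g := by
    intro t t' h
    apply Fin.ext
    rw [← hdec t, ← hdec t']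
    refine freeCode_eq_of_filter_eq free fun k => ?_
    have := congrArg (fun S : Finset (Fin n) => k ∈ S) h
    simpa [g] using this
  have hcard : Fintype.card (Fin (2 ^ n)) = Fintype.card (Finset (Fin n)) := by simp
  have hsurj : Function.Surjective g := (Fintype.bijective_iff_injective_and_card g).2 ⟨hg, hcard⟩ |>.2
  intro T hT
  obtain ⟨t, ht⟩ := hsurj ((Finset.univ : Finset (Fin n)).filter fun k => free k ∈ T)
  refine ⟨t, fun e he => ?_⟩
  obtain ⟨k, rfl⟩ := (hFree e).1 he
  have := congrArg (fun S : Finset (Fin n) => k ∈ S) ht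
  simpa [g] using this

end Decode

end Literature.Probability.Percolation.MarkedLoops
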